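import Literature.Geometry.Kaehler.ComplexTorusIntegralHodgeLatticeLefschetzPiecesMinimalClasses
import Literature.Geometry.Kaehler.ComplexTorusIntegralHodgeLatticeLefschetzPiecesIndexRecursion
import HarnessLib

/-!
# The top minimal class splits off the integral Hodge lattice up to an explicit index:
# `[Hdgᵖ(X, ℤ) : ℤγ_p ⊕ γ_p^⊥] · [ℤ : B(Hdgᵖ(X, ℤ), γ_p)] · (p!·d₁⋯d_p)²·(q!·d₁⋯d_q) = g!·d₁⋯d_g`

Layer `Literature/Geometry/Kaehler`, namespace `Literature.Geometry.Kaehler.ComplexTorus`; lane `lit-hodgefound`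
(Track 2 foundations library), seat p09, generation 48, row g48-#5. THEOREMS ONLY (0 definitions); no named fact, net debt 0.
g48-#3/#4 (`ComplexTorusIntegralHodgeLatticeLefschetzPiecesIndexLowerBound`, `…MinimalClasses`) isolated the top piece of the integral Lefschetz
decomposition of `Hdgᵖ(X, ℤ)` (`k = 2p`, `2p + q = g = j + 2`, type `(d₁, …, d_g)`): the line `ℤγ_p` of the MINIMAL class `γ_p = θ^{∧p}/(p!·d₁⋯d_p)`.
g46-#9 (`ComplexTorusIntegralHodgeLatticePrimitiveSplitting`) split off the BOTTOM piece, the primitive lattice `P`, with `[Hdgᵖ(X, ℤ) : P ⊕ P^⊥] ∣ disc P`.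
Here the top line is split off, for the integral Lefschetz form `B = B_{2p} = ⟨·, γ_q ∧ ·⟩_e` (g45/g46), and everything is EXPLICIT:

* §0 LATTICE GENERALITIES for a line `Λ = ℤγ` in a `ℤ`-module `V` with a bilinear form `B`: **`[V : Λ ⊕ Λ^⊥] · [ℤ : B(γ, V)] = |B(γ, γ)|`**
  (`index_line_sup_orthogonal_mul_index_range_eq_natAbs`: `Λ + Λ^⊥` is the pull-back of `B(γ, γ)ℤ` under `B(γ, ·) : V → ℤ`), hence
  `[V : Λ ⊕ Λ^⊥] ∣ |B(γ, γ)|`; for `B(γ, γ) ≠ 0`: `Λ ∩ Λ^⊥ = 0`, `B∣Λ` non-degenerate, `rk Λ = 1` (`line_inf_orthogonal_eq_bot`, `nondegenerate_restrict_line`,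
  `finrank_line_eq_one`).
* §1 **THE SELF-INTERSECTION OF THE TOP MINIMAL CLASS**: `sign(e)·⟨θ^{∧p}, θ^{∧q} ∧ θ^{∧p}⟩_e = ∫_X θ^{∧g} = (−1)^g·g!·d₁⋯d_g`
  (`IsPolarizationType.orientationSign_mul_poincarePairing_wedgePow_wedgePow_wedge_wedgePow`), so **`sign(e)·(p!·d₁⋯d_p)²·(q!·d₁⋯d_q)·B(γ_p, γ_p) = (−1)^g·g!·d₁⋯d_g`**
  (`IsPolarizationType.orientationSign_mul_content_mul_apply_minimalClass_self`) and `|B(γ_p, γ_p)|·(p!·d₁⋯d_p)²·(q!·d₁⋯d_q) = g!·d₁⋯d_g`, `B(γ_p, γ_p) ≠ 0`.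
* §2 **THE TOP SPLITTING `Hdgᵖ(X, ℤ) ⊇ ℤγ_p ⊕ γ_p^⊥`** (`γ_p^⊥` = the integral Hodge classes of `θ`-degree `0`): `ℤγ_p ∩ γ_p^⊥ = 0`, `rk ℤγ_p = 1`,
  `rk γ_p^⊥ = rk Hdgᵖ(X, ℤ) − 1`, and the INDEX FORMULA **`J_p · m_p · (p!·d₁⋯d_p)²·(q!·d₁⋯d_q) = g!·d₁⋯d_g`** with `J_p = [Hdgᵖ(X, ℤ) : ℤγ_p ⊕ γ_p^⊥]` and
  `m_p = [ℤ : B(γ_p, Hdgᵖ(X, ℤ))]` the index of the value group of `γ_p` on the Hodge lattice (`IsPolarizationType.index_top_splitting_mul_index_range_mul_content_eq`);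
  in particular `J_p ∣ g!·d₁⋯d_g / ((p!·d₁⋯d_p)²·(q!·d₁⋯d_q))`, e.g. `J₁ · m₁ · d₁² = g(g−1)·d₁⋯d_g/(d₁⋯d_{g−2})` for `NS(X)`, and for a principal polarisation
  `J_p · m_p = g!/((p!)²(g−2p)!)`.
* §3 **THE TOWER `Hdgᵖ(X, ℤ) ⊇ ℤγ_p ⊕ γ_p^⊥ ⊇ ⊕_s M_s ⊇ ⊕_s N_s`**: the lower Lefschetz pieces `N_s = Lˢ Hdg^{p−s}(X, ℤ)_prim` and minimal-class pieces `M_s`, `s < p`,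
  are `B`-orthogonal to `γ_p` (`IsPolarizationType.apply_minimalClass_eq_zero_of_mem_lefschetzPiece`, `…_of_mem_minimalClassPiece`), the top minimal-class piece
  `M_p` is `ℤγ_p` (`mem_minimalClassPiece_last_iff`); hence **`J_p ∣ I'_p ∣ I_p`** (`IsPolarizationType.index_top_splitting_dvd_index_comap_iSup_minimalClassPieces`):
  the index of g48-#4's minimal-class decomposition is a multiple of the top splitting index. Everything data-free: `IsPolarizationType.exists_top_splitting`.

## References

* [cite: Lange2023AbelianVarietiesComplex, §5.4.1 Thm. 5.4.2 and (5.22)–(5.23) (PDF p. 275); §2.5.3 Thm. 2.5.16, Cor. 2.5.17 (d) (PDF p. 135); §1.7.2 Lemma 1.7.5; §6.2.4 (PDF p. 310); §7.2.2; §7.3.2 (3)]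
* [cite: VoisinHodgeI2002, §6.3.2 Lemma 6.31, Thm. 6.32 (PDF p. 128); §7.1.2 (PDF p. 134)]
* [cite: Kitaoka1993, Ch. 5 Prop. 5.3.3 (proof)]
* [cite: Huybrechts2016K3, Ch. 14 §0.1–§0.2 (PDF p. 333)]
* [cite: BenoistDebarre2023SmoothSubvarietiesJacobians, §1 (p. 3); §3 proof of Thm. 3.7 (p. 7)]
-/

noncomputable section

-- `Module ℂ` / `SMulZeroClass ℂ` synthesis on `E [⋀^Fin k]→L[ℝ] ℂ` (as in `ComplexTorusLefschetzDecomposition`)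
set_option maxSynthPendingDepth 3

open Module Function Complex
open LinearMap (BilinForm)
open Literature.LinearAlgebra.Alternating
open Literature.Analysis.Complex (IsOfTypeAt typeSubmodule mem_typeSubmodule_iff_isOfTypeAt)

namespace Literature.Geometry.Kaehler.ComplexTorus

/-! ## §0 Lattice generalities: a line and its orthogonal -/

section Generic

variable {V : Type*} [AddCommGroup V]

/-- `Λ^⊥ = ker B(γ, ·)` for the line `Λ = ℤγ`. [folklore] -/
private theorem mem_orthogonal_line_iff₉₅ (B : BilinForm ℤ V) (γ : V) (Λ : Submodule ℤ V) (hΛ : ∀ x, x ∈ Λ ↔ ∃ a : ℤ, a • γ = x) (x : V) :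
    x ∈ B.orthogonal Λ ↔ B γ x = 0 := by
  rw [LinearMap.BilinForm.mem_orthogonal_iff]
  refine ⟨fun h ↦ h γ ((hΛ γ).2 ⟨1, one_smul _ _⟩), fun h n hn ↦ ?_⟩
  obtain ⟨a, rfl⟩ := (hΛ n).1 hn
  rw [show B (a • γ) x = B.flip x (a • γ) from rfl, map_zsmul, show B.flip x γ = B γ x from rfl, h, smul_zero]

/-- **`[V : Λ ⊕ Λ^⊥] · [ℤ : B(γ, V)] = |B(γ, γ)|`** for a line `Λ = ℤγ` in a `ℤ`-module `V` with a bilinear form `B`: `Λ + Λ^⊥` is the pull-back of `B(γ, γ)·ℤ`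
under the linear form `B(γ, ·) : V → ℤ`, whose image `B(γ, V) ⊇ B(γ, γ)·ℤ` has index `[ℤ : B(γ, V)]` (Kitaoka's `V/(Λ ⊥ Λ^⊥) ↪ Λ♯/Λ`, made exact for a line).
[cite: Kitaoka1993, Ch. 5 Prop. 5.3.3 (proof)] [cite: Huybrechts2016K3, Ch. 14 §0.1–§0.2 (PDF p. 333)] -/
theorem index_line_sup_orthogonal_mul_index_range_eq_natAbs (B : BilinForm ℤ V) (γ : V) (Λ : Submodule ℤ V)
    (hΛ : ∀ x, x ∈ Λ ↔ ∃ a : ℤ, a • γ = x) :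
    (Λ ⊔ B.orthogonal Λ).toAddSubgroup.index * (LinearMap.range (B γ)).toAddSubgroup.index = (B γ γ).natAbs := by
  have hO := mem_orthogonal_line_iff₉₅ B γ Λ hΛ
  have hcomap : (Λ ⊔ B.orthogonal Λ).toAddSubgroup = (AddSubgroup.zmultiples (B γ γ)).comap (B γ).toAddMonoidHom := by
    ext x
    simp only [Submodule.mem_toAddSubgroup, AddSubgroup.mem_comap, AddSubgroup.mem_zmultiples_iff, LinearMap.toAddMonoidHom_coe]
    constructor
    · intro hx
      obtain ⟨y, hy, z, hz, rfl⟩ := Submodule.mem_sup.1 hx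
      obtain ⟨a, rfl⟩ := (hΛ y).1 hy
      exact ⟨a, by rw [map_add, (hO z).1 hz, add_zero, map_zsmul]⟩
    · rintro ⟨a, ha⟩
      refine Submodule.mem_sup.2 ⟨a • γ, (hΛ _).2 ⟨a, rfl⟩, x - a • γ, (hO _).2 ?_, by abel⟩
      rw [map_sub, map_zsmul, ← ha, sub_self]
  have hrange : (LinearMap.range (B γ)).toAddSubgroup = (B γ).toAddMonoidHom.range := AddSubgroup.ext fun _ ↦ Iff.rfl
  have hle : AddSubgroup.zmultiples (B γ γ) ≤ (B γ).toAddMonoidHom.range := AddSubgroup.zmultiples_le_of_mem ⟨γ, rfl⟩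
  rw [hcomap, hrange, ← AddSubgroup.relIndex_top_right, AddSubgroup.relIndex_comap, ← AddMonoidHom.range_eq_map,
    AddSubgroup.relIndex_mul_index hle, Int.index_zmultiples]

/-- **`[V : Λ ⊕ Λ^⊥] ∣ |B(γ, γ)|`** for a line `Λ = ℤγ`. [cite: Kitaoka1993, Ch. 5 Prop. 5.3.3 (proof)] [cite: Huybrechts2016K3, Ch. 14 §0.2] -/
theorem index_line_sup_orthogonal_dvd_natAbs (B : BilinForm ℤ V) (γ : V) (Λ : Submodule ℤ V) (hΛ : ∀ x, x ∈ Λ ↔ ∃ a : ℤ, a • γ = x) :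
    (Λ ⊔ B.orthogonal Λ).toAddSubgroup.index ∣ (B γ γ).natAbs :=
  Dvd.intro _ (index_line_sup_orthogonal_mul_index_range_eq_natAbs B γ Λ hΛ)

/-- **`[ℤ : B(γ, V)] ∣ |B(γ, γ)|`**: the value group of `γ` contains `B(γ, γ)`. [folklore] [cite: Huybrechts2016K3, Ch. 14 §0.1] -/
theorem index_range_dvd_natAbs (B : BilinForm ℤ V) (γ : V) : (LinearMap.range (B γ)).toAddSubgroup.index ∣ (B γ γ).natAbs := by
  obtain ⟨Λ, hΛ⟩ : ∃ Λ : Submodule ℤ V, ∀ x, x ∈ Λ ↔ ∃ a : ℤ, a • γ = x := ⟨ℤ ∙ γ, fun x ↦ Submodule.mem_span_singleton⟩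
  exact Dvd.intro_left _ (index_line_sup_orthogonal_mul_index_range_eq_natAbs B γ Λ hΛ)

/-- **`0 < [V : Λ ⊕ Λ^⊥]` and `0 < [ℤ : B(γ, V)]`** when `B(γ, γ) ≠ 0`. [cite: Kitaoka1993, Ch. 5 Prop. 5.3.3] -/
theorem index_line_sup_orthogonal_pos (B : BilinForm ℤ V) (γ : V) (Λ : Submodule ℤ V) (hΛ : ∀ x, x ∈ Λ ↔ ∃ a : ℤ, a • γ = x)
    (h0 : B γ γ ≠ 0) : 0 < (Λ ⊔ B.orthogonal Λ).toAddSubgroup.index ∧ 0 < (LinearMap.range (B γ)).toAddSubgroup.index := by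
  have h := index_line_sup_orthogonal_mul_index_range_eq_natAbs B γ Λ hΛ
  have hne : (Λ ⊔ B.orthogonal Λ).toAddSubgroup.index * (LinearMap.range (B γ)).toAddSubgroup.index ≠ 0 := by
    rw [h]
    exact Int.natAbs_ne_zero.2 h0
  exact ⟨Nat.pos_of_ne_zero (left_ne_zero_of_mul hne), Nat.pos_of_ne_zero (right_ne_zero_of_mul hne)⟩

/-- **`Λ ∩ Λ^⊥ = 0`** for a line `Λ = ℤγ` with `B(γ, γ) ≠ 0`. [cite: Kitaoka1993, Ch. 5 Prop. 5.3.3] [cite: Huybrechts2016K3, Ch. 14 §0.2] -/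
theorem line_inf_orthogonal_eq_bot (B : BilinForm ℤ V) (γ : V) (Λ : Submodule ℤ V) (hΛ : ∀ x, x ∈ Λ ↔ ∃ a : ℤ, a • γ = x)
    (h0 : B γ γ ≠ 0) : Λ ⊓ B.orthogonal Λ = ⊥ := by
  refine eq_bot_iff.2 fun x hx ↦ ?_
  obtain ⟨a, rfl⟩ := (hΛ x).1 hx.1
  have h := (mem_orthogonal_line_iff₉₅ B γ Λ hΛ _).1 hx.2
  rw [map_zsmul, zsmul_eq_mul, Int.cast_id, mul_eq_zero] at h
  rw [h.resolve_right h0, zero_zsmul, Submodule.mem_bot]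

/-- **`B∣Λ` is non-degenerate** for a line `Λ = ℤγ` with `B(γ, γ) ≠ 0`. [cite: Kitaoka1993, Ch. 5 Prop. 5.3.3] -/
theorem nondegenerate_restrict_line (B : BilinForm ℤ V) (γ : V) (Λ : Submodule ℤ V) (hΛ : ∀ x, x ∈ Λ ↔ ∃ a : ℤ, a • γ = x)
    (h0 : B γ γ ≠ 0) : (B.restrict Λ).Nondegenerate := by
  have hγ : γ ∈ Λ := (hΛ γ).2 ⟨1, one_smul _ _⟩
  have key : ∀ x : ↥Λ, B (x : V) γ = 0 ∨ B γ (x : V) = 0 → x = 0 := fun x hx ↦ by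
    obtain ⟨a, ha⟩ := (hΛ x).1 x.2
    have h : a * B γ γ = 0 := by
      rcases hx with hx | hx
      · rw [← ha, show B (a • γ) γ = B.flip γ (a • γ) from rfl, map_zsmul, zsmul_eq_mul] at hx
        exact hx
      · rw [← ha, map_zsmul, zsmul_eq_mul] at hx
        exact hx
    exact Subtype.ext (by rw [← ha, (mul_eq_zero.1 h).resolve_right h0, zero_zsmul]; rfl)
  refine ⟨fun x hx ↦ key x (Or.inl (hx ⟨γ, hγ⟩)), fun x hx ↦ key x (Or.inr (hx ⟨γ, hγ⟩))⟩

/-- **`rk ℤγ = 1`** when `γ` is not a torsion element. [folklore] [cite: Huybrechts2016K3, Ch. 14 §0.1] -/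
theorem finrank_line_eq_one (γ : V) (Λ : Submodule ℤ V) (hΛ : ∀ x, x ∈ Λ ↔ ∃ a : ℤ, a • γ = x) (hγ : ∀ a : ℤ, a • γ = 0 → a = 0) :
    finrank ℤ ↥Λ = 1 := by
  have hli : LinearIndependent ℤ (fun _ : Fin 1 ↦ γ) := by
    rw [Fintype.linearIndependent_iff]
    intro g hg i
    rw [Fin.sum_univ_one] at hg
    rw [Subsingleton.elim i 0]
    exact hγ _ hg
  have hΛeq : Λ = Submodule.span ℤ (Set.range fun _ : Fin 1 ↦ γ) := by
    refine le_antisymm (fun x hx ↦ ?_) (Submodule.span_le.2 (Set.range_subset_iff.2 fun _ ↦ (hΛ _).2 ⟨1, one_zsmul γ⟩))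
    obtain ⟨a, rfl⟩ := (hΛ x).1 hx
    exact Submodule.smul_mem _ a (Submodule.subset_span ⟨0, rfl⟩)
  rw [hΛeq]
  exact (finrank_span_eq_card hli).trans (Fintype.card_fin 1)

end Generic

/-! ## §1 The self-intersection of the top minimal class: `sign(e)·(p!·d₁⋯d_p)²·(q!·d₁⋯d_q)·B(γ_p, γ_p) = (−1)^g·g!·d₁⋯d_g` -/

section Value

variable {ι : Type*} [Fintype ι] [DecidableEq ι] {E : Type*} [NormedAddCommGroup E] [NormedSpace ℂ E]
  (Φ : (ι → ℝ) ≃L[ℝ] E) {n : ℕ} {η : E [⋀^Fin 2]→L[ℝ] ℝ}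

omit [Fintype ι] in
/-- The orientation sign of a re-typed enumeration. [folklore] -/
private theorem orientationSign_finCongr_trans₉₅ {m : ℕ} (h : m = n) (e : Fin n ≃ ι) :
    orientationSign Φ ((finCongr h).trans e) = orientationSign Φ e := by
  subst h
  rfl

/-- **`sign(e)·⟨θ^{∧p}, θ^{∧q} ∧ θ^{∧p}⟩_e = ∫_X θ^{∧g} = (−1)^g·g!·d₁⋯d_g`** for a polarisation `θ` of type `(d₁, …, d_g)` and `p + q + p = g`: the
self-intersection of `θ^{∧p}` for the Lefschetz pairing `⟨·, θ^{∧q} ∧ ·⟩_e` of `H^{2p}(X, ℂ)` is the degree `(θ^g) = g!·d₁⋯d_g` (with Lange's sign `(−1)^g`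
of `∫_X` on the symplectic frame and the orientation sign of `e`).
[cite: Lange2023AbelianVarietiesComplex, §1.7.2 Lemma 1.7.5; §2.5.3 Cor. 2.5.17 (d) (PDF p. 135); §6.2.4 (PDF p. 310)] -/
theorem IsPolarizationType.orientationSign_mul_poincarePairing_wedgePow_wedgePow_wedge_wedgePow {g : ℕ} {d : Fin g → ℕ}
    (hd : IsPolarizationType Φ η d) (hη : IsRiemannForm Φ η) {p q : ℕ} (hg : p + (q + p) = g) (e : Fin n ≃ ι)
    (hn : 2 * p + (2 * q + 2 * p) = n) :
    (orientationSign Φ e : ℂ) *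
        poincarePairing Φ e hn (wedgePow (ofRealForm η) p) ((wedgePow (ofRealForm η) q).wedge (wedgePow (ofRealForm η) p)) =
      (-1) ^ g * (g.factorial : ℂ) * ∏ i, (d i : ℂ) := by
  subst hg
  rw [poincarePairing_eq_orientationSign_mul_torusIntegral_wedge Φ e hn, orientationSign_finCongr_trans₉₅ Φ hn e, ← mul_assoc,
    ← Int.cast_mul, orientationSign_mul_self, Int.cast_one, one_mul]
  rw [wedgePow_wedge_wedgePow (ofRealForm η) q p]
  rw [wedge_domDomCongr_finCongr]
  rw [wedgePow_wedge_wedgePow (ofRealForm η) p (q + p)]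
  rw [domDomCongr_finCongr_trans]
  rw [← torusIntegral_finCongr_trans Φ]
  exact hη.torusIntegral_wedgePow_of_isPolarizationType Φ hd _

variable {Φ} {j : ℕ} {d : Fin (j + 2) → ℕ}

/-- **`sign(e)·(p!·d₁⋯d_p)²·(q!·d₁⋯d_q)·⟨γ_p, γ_q ∧ γ_p⟩_e = (−1)^g·g!·d₁⋯d_g`** for the minimal classes `γ_p = θ^{∧p}/(p!·d₁⋯d_p)`,
`γ_q = θ^{∧q}/(q!·d₁⋯d_q)` (`2p + q = g`). [cite: Lange2023AbelianVarietiesComplex, §2.5.3 Thm. 2.5.16, Cor. 2.5.17 (d) (PDF p. 135); §1.7.2 Lemma 1.7.5; §6.2.4 (PDF p. 310)] [cite: BenoistDebarre2023SmoothSubvarietiesJacobians, §1 (p. 3)] -/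
theorem IsPolarizationType.orientationSign_mul_content_mul_poincarePairing_minimalClass_self (hd : IsPolarizationType Φ η d)
    (hη : IsRiemannForm Φ η) {p q : ℕ} (hp : p ≤ j + 2) (hq : q ≤ j + 2) (hg : p + (q + p) = j + 2)
    {γp : E [⋀^Fin (2 * p)]→L[ℝ] ℂ} (hγp : wedgePow (ofRealForm η) p = ((p.factorial * ∏ i : Fin p, d (Fin.castLE hp i) : ℕ) : ℂ) • γp)
    {γq : E [⋀^Fin (2 * q)]→L[ℝ] ℂ} (hγq : wedgePow (ofRealForm η) q = ((q.factorial * ∏ i : Fin q, d (Fin.castLE hq i) : ℕ) : ℂ) • γq)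
    (e : Fin n ≃ ι) (hn : 2 * p + (2 * q + 2 * p) = n) :
    (orientationSign Φ e : ℂ) * (((p.factorial * ∏ i : Fin p, d (Fin.castLE hp i)) ^ 2 * (q.factorial * ∏ i : Fin q, d (Fin.castLE hq i)) : ℕ) : ℂ) *
        poincarePairing Φ e hn γp (γq.wedge γp) =
      (-1) ^ (j + 2) * ((j + 2).factorial : ℂ) * ∏ i, (d i : ℂ) := by
  have h := hd.orientationSign_mul_poincarePairing_wedgePow_wedgePow_wedge_wedgePow Φ hη hg e hn
  rw [hγp, hγq, map_smul, LinearMap.smul_apply, wedge_smul_left_complex, wedge_smul_right_complex, map_smul, map_smul,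
    smul_eq_mul, smul_eq_mul, smul_eq_mul] at h
  rw [← h]
  push_cast
  ring

/-- **`sign(e)·(p!·d₁⋯d_p)²·(q!·d₁⋯d_q)·B(γ_p, γ_p) = (−1)^g·g!·d₁⋯d_g` in `ℤ`** for the integral Lefschetz form `B = ⟨·, γ_q ∧ ·⟩_e` of `H^{2p}(X, ℤ)`.
[cite: Lange2023AbelianVarietiesComplex, §2.5.3 Thm. 2.5.16, Cor. 2.5.17 (d) (PDF p. 135); §1.7.2 Lemma 1.7.5; §6.2.4 (PDF p. 310)] [cite: VoisinHodgeI2002, §7.1.2 (PDF p. 134)] -/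
theorem IsPolarizationType.orientationSign_mul_content_mul_apply_minimalClass_self (hd : IsPolarizationType Φ η d)
    (hη : IsRiemannForm Φ η) {p q : ℕ} (hp : p ≤ j + 2) (hq : q ≤ j + 2) (hg : p + (q + p) = j + 2)
    {γp : E [⋀^Fin (2 * p)]→L[ℝ] ℂ} (hγp : wedgePow (ofRealForm η) p = ((p.factorial * ∏ i : Fin p, d (Fin.castLE hp i) : ℕ) : ℂ) • γp)
    {γq : E [⋀^Fin (2 * q)]→L[ℝ] ℂ} (hγq : wedgePow (ofRealForm η) q = ((q.factorial * ∏ i : Fin q, d (Fin.castLE hq i) : ℕ) : ℂ) • γq)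
    (e : Fin n ≃ ι) (hn : 2 * p + (2 * q + 2 * p) = n) {B : BilinForm ℤ ↥(integralForms Φ (2 * p))}
    (hB : ∀ x y : ↥(integralForms Φ (2 * p)),
      ((B x y : ℤ) : ℂ) = poincarePairing Φ e hn (x : E [⋀^Fin (2 * p)]→L[ℝ] ℂ) (γq.wedge (y : E [⋀^Fin (2 * p)]→L[ℝ] ℂ)))
    (γpZ : ↥(integralForms Φ (2 * p))) (hγpZ : (γpZ : E [⋀^Fin (2 * p)]→L[ℝ] ℂ) = γp) :
    orientationSign Φ e * (((p.factorial * ∏ i : Fin p, d (Fin.castLE hp i)) ^ 2 * (q.factorial * ∏ i : Fin q, d (Fin.castLE hq i)) : ℕ) : ℤ) *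
        B γpZ γpZ = (-1) ^ (j + 2) * (((j + 2).factorial * ∏ i, d i : ℕ) : ℤ) := by
  apply Int.cast_injective (α := ℂ)
  have h := hd.orientationSign_mul_content_mul_poincarePairing_minimalClass_self hη hp hq hg hγp hγq e hn
  rw [← hγpZ, ← hB] at h
  push_cast at h ⊢
  linear_combination h

/-- **`|B(γ_p, γ_p)|·(p!·d₁⋯d_p)²·(q!·d₁⋯d_q) = g!·d₁⋯d_g`**, so `B(γ_p, γ_p) ≠ 0`; e.g. `|B(γ₁, γ₁)|·d₁² = g(g−1)·d_{g−1}d_g` on `NS(X)` and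
`|B(γ_p, γ_p)| = g!/((p!)²(g−2p)!)` for a principal polarisation. [cite: Lange2023AbelianVarietiesComplex, §2.5.3 Cor. 2.5.17 (d) (PDF p. 135); §5.4.1 (5.23) (PDF p. 275)] -/
theorem IsPolarizationType.natAbs_apply_minimalClass_self_mul_content_eq (hd : IsPolarizationType Φ η d)
    (hη : IsRiemannForm Φ η) {p q : ℕ} (hp : p ≤ j + 2) (hq : q ≤ j + 2) (hg : p + (q + p) = j + 2)
    {γp : E [⋀^Fin (2 * p)]→L[ℝ] ℂ} (hγp : wedgePow (ofRealForm η) p = ((p.factorial * ∏ i : Fin p, d (Fin.castLE hp i) : ℕ) : ℂ) • γp)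
    {γq : E [⋀^Fin (2 * q)]→L[ℝ] ℂ} (hγq : wedgePow (ofRealForm η) q = ((q.factorial * ∏ i : Fin q, d (Fin.castLE hq i) : ℕ) : ℂ) • γq)
    (e : Fin n ≃ ι) (hn : 2 * p + (2 * q + 2 * p) = n) {B : BilinForm ℤ ↥(integralForms Φ (2 * p))}
    (hB : ∀ x y : ↥(integralForms Φ (2 * p)),
      ((B x y : ℤ) : ℂ) = poincarePairing Φ e hn (x : E [⋀^Fin (2 * p)]→L[ℝ] ℂ) (γq.wedge (y : E [⋀^Fin (2 * p)]→L[ℝ] ℂ)))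
    (γpZ : ↥(integralForms Φ (2 * p))) (hγpZ : (γpZ : E [⋀^Fin (2 * p)]→L[ℝ] ℂ) = γp) :
    (B γpZ γpZ).natAbs * ((p.factorial * ∏ i : Fin p, d (Fin.castLE hp i)) ^ 2 * (q.factorial * ∏ i : Fin q, d (Fin.castLE hq i))) =
      (j + 2).factorial * ∏ i, d i ∧ B γpZ γpZ ≠ 0 := by
  have h := congrArg Int.natAbs (hd.orientationSign_mul_content_mul_apply_minimalClass_self hη hp hq hg hγp hγq e hn hB γpZ hγpZ)
  have hs : (orientationSign Φ e).natAbs = 1 := by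
    have h1 := congrArg Int.natAbs (orientationSign_mul_self Φ e)
    rw [Int.natAbs_mul, Int.natAbs_one] at h1
    exact Nat.eq_one_of_mul_eq_one_left h1
  simp only [Int.natAbs_mul, Int.natAbs_pow, Int.natAbs_neg, Int.natAbs_one, one_pow, one_mul, Int.natAbs_natCast, hs] at h
  have hpos : 0 < (j + 2).factorial * ∏ i, d i := Nat.mul_pos (Nat.factorial_pos _) (Finset.prod_pos fun i _ ↦ hd.pos hη i)
  refine ⟨by rw [← h, mul_comm], fun h0 ↦ ?_⟩
  rw [h0, Int.natAbs_zero, mul_zero] at h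
  exact hpos.ne' h.symm

end Value

/-! ## §2 The top splitting `Hdgᵖ(X, ℤ) ⊇ ℤγ_p ⊕ γ_p^⊥` and its index -/

section Splitting

variable {ι : Type*} [Fintype ι] [DecidableEq ι] {E : Type*} [NormedAddCommGroup E] [NormedSpace ℂ E]
  {Φ : (ι → ℝ) ≃L[ℝ] E} {j n p q : ℕ} {η : E [⋀^Fin 2]→L[ℝ] ℝ} {d : Fin (j + 2) → ℕ}

omit [DecidableEq ι] in
/-- **The minimal class lives in the Hodge lattice**: there is `γ ∈ Hdgᵖ(X, ℤ) ⊆ H^{2p}(X, ℤ)` (as an element of the sublattice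
`M = Hdgᵖ(X, ℤ)` of `H^{2p}(X, ℤ)`) with `θ^{∧p} = (p!·d₁⋯d_p)·γ`. [cite: Lange2023AbelianVarietiesComplex, §2.5.3 Thm. 2.5.16 (PDF p. 135); §7.2.2] -/
theorem IsPolarizationType.exists_minimalClass_mem_toIntSubmodule (hd : IsPolarizationType Φ η d) (hη : IsRiemannForm Φ η) (hp : p ≤ j + 2) :
    ∃ γM : ↥(AddSubgroup.toIntSubmodule ((integralHodgeClassesIn Φ (2 * p) p).addSubgroupOf (integralForms Φ (2 * p)))),
      wedgePow (ofRealForm η) p = ((p.factorial * ∏ i : Fin p, d (Fin.castLE hp i) : ℕ) : ℂ) •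
        (((γM : ↥(AddSubgroup.toIntSubmodule ((integralHodgeClassesIn Φ (2 * p) p).addSubgroupOf (integralForms Φ (2 * p))))) :
          ↥(integralForms Φ (2 * p))) : E [⋀^Fin (2 * p)]→L[ℝ] ℂ) := by
  classical
  obtain ⟨γ, hγZ, hγ⟩ := hd.exists_mem_integralForms_wedgePow_eq_content_smul hp
  have hγH := mem_integralHodgeClassesIn_of_wedgePow_eq_content_smul hd hη hp hγZ hγ
  exact ⟨⟨⟨γ, hγZ⟩, AddSubgroup.mem_addSubgroupOf.2 hγH⟩, hγ⟩

/-- **THE INDEX FORMULA OF THE TOP SPLITTING: `[Hdgᵖ(X, ℤ) : ℤγ_p ⊕ γ_p^⊥] · [ℤ : B(γ_p, Hdgᵖ(X, ℤ))] · (p!·d₁⋯d_p)²·(q!·d₁⋯d_q) = g!·d₁⋯d_g`**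
(`2p + q = g`; `M = Hdgᵖ(X, ℤ) ⊆ H^{2p}(X, ℤ)`, `B_M = B∣M` the integral Lefschetz form `⟨·, γ_q ∧ ·⟩_e`, `Λ = ℤγ_p`, `γ_p^⊥ = Λ^⊥` for `B_M`; the second factor
is the index in `ℤ` of the value group `{B(γ_p, x) : x ∈ Hdgᵖ(X, ℤ)}`); both indices are positive, `[Hdgᵖ(X, ℤ) : ℤγ_p ⊕ γ_p^⊥] · [ℤ : B(γ_p, Hdgᵖ)] = |B(γ_p, γ_p)|`.
[cite: Lange2023AbelianVarietiesComplex, §5.4.1 Thm. 5.4.2 and (5.22)–(5.23) (PDF p. 275); §2.5.3 Cor. 2.5.17 (d) (PDF p. 135); §7.3.2 (3)] [cite: Kitaoka1993, Ch. 5 Prop. 5.3.3 (proof)] [cite: Huybrechts2016K3, Ch. 14 §0.2] -/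
theorem IsPolarizationType.index_top_splitting_mul_index_range_mul_content_eq (hd : IsPolarizationType Φ η d) (hη : IsRiemannForm Φ η)
    (hp : p ≤ j + 2) (hq : q ≤ j + 2) (hg : p + (q + p) = j + 2)
    {γq : E [⋀^Fin (2 * q)]→L[ℝ] ℂ} (hγq : wedgePow (ofRealForm η) q = ((q.factorial * ∏ i : Fin q, d (Fin.castLE hq i) : ℕ) : ℂ) • γq)
    (e : Fin n ≃ ι) (hn : 2 * p + (2 * q + 2 * p) = n) {B : BilinForm ℤ ↥(integralForms Φ (2 * p))}
    (hB : ∀ x y : ↥(integralForms Φ (2 * p)),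
      ((B x y : ℤ) : ℂ) = poincarePairing Φ e hn (x : E [⋀^Fin (2 * p)]→L[ℝ] ℂ) (γq.wedge (y : E [⋀^Fin (2 * p)]→L[ℝ] ℂ)))
    (γM : ↥(AddSubgroup.toIntSubmodule ((integralHodgeClassesIn Φ (2 * p) p).addSubgroupOf (integralForms Φ (2 * p)))))
    (hγM : wedgePow (ofRealForm η) p = ((p.factorial * ∏ i : Fin p, d (Fin.castLE hp i) : ℕ) : ℂ) •
      (((γM : ↥(AddSubgroup.toIntSubmodule ((integralHodgeClassesIn Φ (2 * p) p).addSubgroupOf (integralForms Φ (2 * p))))) :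
        ↥(integralForms Φ (2 * p))) : E [⋀^Fin (2 * p)]→L[ℝ] ℂ))
    (Λ : Submodule ℤ ↥(AddSubgroup.toIntSubmodule ((integralHodgeClassesIn Φ (2 * p) p).addSubgroupOf (integralForms Φ (2 * p)))))
    (hΛ : ∀ x, x ∈ Λ ↔ ∃ a : ℤ, a • γM = x) :
    (Λ ⊔ (B.restrict (AddSubgroup.toIntSubmodule ((integralHodgeClassesIn Φ (2 * p) p).addSubgroupOf (integralForms Φ (2 * p))))).orthogonal Λ).toAddSubgroup.index *
        (LinearMap.range (B.restrict (AddSubgroup.toIntSubmodule ((integralHodgeClassesIn Φ (2 * p) p).addSubgroupOf (integralForms Φ (2 * p)))) γM)).toAddSubgroup.index *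
          ((p.factorial * ∏ i : Fin p, d (Fin.castLE hp i)) ^ 2 * (q.factorial * ∏ i : Fin q, d (Fin.castLE hq i))) = (j + 2).factorial * ∏ i, d i ∧
      (Λ ⊔ (B.restrict (AddSubgroup.toIntSubmodule ((integralHodgeClassesIn Φ (2 * p) p).addSubgroupOf (integralForms Φ (2 * p))))).orthogonal Λ).toAddSubgroup.index *
        (LinearMap.range (B.restrict (AddSubgroup.toIntSubmodule ((integralHodgeClassesIn Φ (2 * p) p).addSubgroupOf (integralForms Φ (2 * p)))) γM)).toAddSubgroup.index =
          (B (γM : ↥(integralForms Φ (2 * p))) (γM : ↥(integralForms Φ (2 * p)))).natAbs ∧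
      0 < (Λ ⊔ (B.restrict (AddSubgroup.toIntSubmodule ((integralHodgeClassesIn Φ (2 * p) p).addSubgroupOf (integralForms Φ (2 * p))))).orthogonal Λ).toAddSubgroup.index ∧
      0 < (LinearMap.range (B.restrict (AddSubgroup.toIntSubmodule ((integralHodgeClassesIn Φ (2 * p) p).addSubgroupOf (integralForms Φ (2 * p)))) γM)).toAddSubgroup.index := by
  have h1 := index_line_sup_orthogonal_mul_index_range_eq_natAbs
    (B.restrict (AddSubgroup.toIntSubmodule ((integralHodgeClassesIn Φ (2 * p) p).addSubgroupOf (integralForms Φ (2 * p))))) γM Λ hΛ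
  have h2 := hd.natAbs_apply_minimalClass_self_mul_content_eq hη hp hq hg hγM hγq e hn hB (γM : ↥(integralForms Φ (2 * p))) rfl
  have h3 := index_line_sup_orthogonal_pos
    (B.restrict (AddSubgroup.toIntSubmodule ((integralHodgeClassesIn Φ (2 * p) p).addSubgroupOf (integralForms Φ (2 * p))))) γM Λ hΛ h2.2
  exact ⟨by rw [h1]; exact h2.1, h1, h3⟩

/-- **`[Hdgᵖ(X, ℤ) : ℤγ_p ⊕ γ_p^⊥]` and `[ℤ : B(γ_p, Hdgᵖ(X, ℤ))]` divide `|B(γ_p, γ_p)| = g!·d₁⋯d_g / ((p!·d₁⋯d_p)²·(q!·d₁⋯d_q))`**.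
[cite: Kitaoka1993, Ch. 5 Prop. 5.3.3 (proof)] [cite: Lange2023AbelianVarietiesComplex, §5.4.1 (5.22)–(5.23) (PDF p. 275); §2.5.3 Cor. 2.5.17 (d)] -/
theorem IsPolarizationType.index_top_splitting_dvd_natAbs (hd : IsPolarizationType Φ η d) (hη : IsRiemannForm Φ η)
    (hp : p ≤ j + 2) (hq : q ≤ j + 2) (hg : p + (q + p) = j + 2)
    {γq : E [⋀^Fin (2 * q)]→L[ℝ] ℂ} (hγq : wedgePow (ofRealForm η) q = ((q.factorial * ∏ i : Fin q, d (Fin.castLE hq i) : ℕ) : ℂ) • γq)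
    (e : Fin n ≃ ι) (hn : 2 * p + (2 * q + 2 * p) = n) {B : BilinForm ℤ ↥(integralForms Φ (2 * p))}
    (hB : ∀ x y : ↥(integralForms Φ (2 * p)),
      ((B x y : ℤ) : ℂ) = poincarePairing Φ e hn (x : E [⋀^Fin (2 * p)]→L[ℝ] ℂ) (γq.wedge (y : E [⋀^Fin (2 * p)]→L[ℝ] ℂ)))
    (γM : ↥(AddSubgroup.toIntSubmodule ((integralHodgeClassesIn Φ (2 * p) p).addSubgroupOf (integralForms Φ (2 * p)))))
    (hγM : wedgePow (ofRealForm η) p = ((p.factorial * ∏ i : Fin p, d (Fin.castLE hp i) : ℕ) : ℂ) •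
      (((γM : ↥(AddSubgroup.toIntSubmodule ((integralHodgeClassesIn Φ (2 * p) p).addSubgroupOf (integralForms Φ (2 * p))))) :
        ↥(integralForms Φ (2 * p))) : E [⋀^Fin (2 * p)]→L[ℝ] ℂ))
    (Λ : Submodule ℤ ↥(AddSubgroup.toIntSubmodule ((integralHodgeClassesIn Φ (2 * p) p).addSubgroupOf (integralForms Φ (2 * p)))))
    (hΛ : ∀ x, x ∈ Λ ↔ ∃ a : ℤ, a • γM = x) :
    (Λ ⊔ (B.restrict (AddSubgroup.toIntSubmodule ((integralHodgeClassesIn Φ (2 * p) p).addSubgroupOf (integralForms Φ (2 * p))))).orthogonal Λ).toAddSubgroup.index ∣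
        (B (γM : ↥(integralForms Φ (2 * p))) (γM : ↥(integralForms Φ (2 * p)))).natAbs ∧
      (LinearMap.range (B.restrict (AddSubgroup.toIntSubmodule ((integralHodgeClassesIn Φ (2 * p) p).addSubgroupOf (integralForms Φ (2 * p)))) γM)).toAddSubgroup.index ∣
        (B (γM : ↥(integralForms Φ (2 * p))) (γM : ↥(integralForms Φ (2 * p)))).natAbs ∧
      (B (γM : ↥(integralForms Φ (2 * p))) (γM : ↥(integralForms Φ (2 * p)))).natAbs *
          ((p.factorial * ∏ i : Fin p, d (Fin.castLE hp i)) ^ 2 * (q.factorial * ∏ i : Fin q, d (Fin.castLE hq i))) = (j + 2).factorial * ∏ i, d i := by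
  have h := (hd.index_top_splitting_mul_index_range_mul_content_eq hη hp hq hg hγq e hn hB γM hγM Λ hΛ).2.1
  exact ⟨Dvd.intro _ h, Dvd.intro_left _ h,
    (hd.natAbs_apply_minimalClass_self_mul_content_eq hη hp hq hg hγM hγq e hn hB (γM : ↥(integralForms Φ (2 * p))) rfl).1⟩

/-- **The top splitting is a splitting: `ℤγ_p ∩ γ_p^⊥ = 0`, `B∣ℤγ_p` non-degenerate, `rk ℤγ_p = 1`, `rk ℤγ_p + rk γ_p^⊥ = rk Hdgᵖ(X, ℤ)`**
(`B(γ_p, γ_p) ≠ 0`; `B_M` is symmetric, g46-#1). [cite: Lange2023AbelianVarietiesComplex, §5.4.1 Thm. 5.4.2 and (5.22) (PDF p. 275); §7.3.2 (3)] [cite: VoisinHodgeI2002, §6.3.2 Lemma 6.31 (PDF p. 128)] [cite: Kitaoka1993, Ch. 5 Prop. 5.3.3] -/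
theorem IsPolarizationType.top_splitting (hd : IsPolarizationType Φ η d) (hη : IsRiemannForm Φ η)
    (hp : p ≤ j + 2) (hq : q ≤ j + 2) (hg : p + (q + p) = j + 2)
    {γq : E [⋀^Fin (2 * q)]→L[ℝ] ℂ} (hγq : wedgePow (ofRealForm η) q = ((q.factorial * ∏ i : Fin q, d (Fin.castLE hq i) : ℕ) : ℂ) • γq)
    (e : Fin n ≃ ι) (hn : 2 * p + (2 * q + 2 * p) = n) {B : BilinForm ℤ ↥(integralForms Φ (2 * p))}
    (hB : ∀ x y : ↥(integralForms Φ (2 * p)),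
      ((B x y : ℤ) : ℂ) = poincarePairing Φ e hn (x : E [⋀^Fin (2 * p)]→L[ℝ] ℂ) (γq.wedge (y : E [⋀^Fin (2 * p)]→L[ℝ] ℂ)))
    (γM : ↥(AddSubgroup.toIntSubmodule ((integralHodgeClassesIn Φ (2 * p) p).addSubgroupOf (integralForms Φ (2 * p)))))
    (hγM : wedgePow (ofRealForm η) p = ((p.factorial * ∏ i : Fin p, d (Fin.castLE hp i) : ℕ) : ℂ) •
      (((γM : ↥(AddSubgroup.toIntSubmodule ((integralHodgeClassesIn Φ (2 * p) p).addSubgroupOf (integralForms Φ (2 * p))))) :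
        ↥(integralForms Φ (2 * p))) : E [⋀^Fin (2 * p)]→L[ℝ] ℂ))
    (Λ : Submodule ℤ ↥(AddSubgroup.toIntSubmodule ((integralHodgeClassesIn Φ (2 * p) p).addSubgroupOf (integralForms Φ (2 * p)))))
    (hΛ : ∀ x, x ∈ Λ ↔ ∃ a : ℤ, a • γM = x) :
    Λ ⊓ (B.restrict (AddSubgroup.toIntSubmodule ((integralHodgeClassesIn Φ (2 * p) p).addSubgroupOf (integralForms Φ (2 * p))))).orthogonal Λ = ⊥ ∧
      ((B.restrict (AddSubgroup.toIntSubmodule ((integralHodgeClassesIn Φ (2 * p) p).addSubgroupOf (integralForms Φ (2 * p))))).restrict Λ).Nondegenerate ∧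
      finrank ℤ ↥Λ = 1 ∧
      finrank ℤ ↥Λ + finrank ℤ ↥((B.restrict (AddSubgroup.toIntSubmodule ((integralHodgeClassesIn Φ (2 * p) p).addSubgroupOf (integralForms Φ (2 * p))))).orthogonal Λ) =
        finrank ℤ ↥(AddSubgroup.toIntSubmodule ((integralHodgeClassesIn Φ (2 * p) p).addSubgroupOf (integralForms Φ (2 * p)))) := by
  classical
  letI : LinearOrder ι := LinearOrder.lift' (Fintype.equivFin ι) (Fintype.equivFin ι).injective
  have sb := Submodule.basisOfPid (intLatMonomialBasis Φ (2 * p))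
    (AddSubgroup.toIntSubmodule ((integralHodgeClassesIn Φ (2 * p) p).addSubgroupOf (integralForms Φ (2 * p))))
  haveI : Module.Finite ℤ ↥(AddSubgroup.toIntSubmodule ((integralHodgeClassesIn Φ (2 * p) p).addSubgroupOf (integralForms Φ (2 * p)))) :=
    Module.Finite.of_basis sb.2
  haveI : Module.Free ℤ ↥(AddSubgroup.toIntSubmodule ((integralHodgeClassesIn Φ (2 * p) p).addSubgroupOf (integralForms Φ (2 * p)))) :=
    Module.Free.of_basis sb.2
  have h0 := (hd.natAbs_apply_minimalClass_self_mul_content_eq hη hp hq hg hγM hγq e hn hB (γM : ↥(integralForms Φ (2 * p))) rfl).2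
  have hkq : 2 * p + q = j + 2 := by omega
  have hBs : B.IsSymm := hd.isSymm_of_eq_poincarePairing_wedge_of_even hη (even_two_mul p) hkq hq hγq e hn hB
  have hnd := nondegenerate_restrict_line
    (B.restrict (AddSubgroup.toIntSubmodule ((integralHodgeClassesIn Φ (2 * p) p).addSubgroupOf (integralForms Φ (2 * p))))) γM Λ hΛ h0
  have htf : ∀ a : ℤ, a • γM = 0 → a = 0 := fun a ha ↦ by
    have h' : B (γM : ↥(integralForms Φ (2 * p)))
        (((a • γM : ↥(AddSubgroup.toIntSubmodule ((integralHodgeClassesIn Φ (2 * p) p).addSubgroupOf (integralForms Φ (2 * p)))))) :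
          ↥(integralForms Φ (2 * p))) = 0 := by
      rw [ha, Submodule.coe_zero, map_zero]
    rw [show (((a • γM : ↥(AddSubgroup.toIntSubmodule ((integralHodgeClassesIn Φ (2 * p) p).addSubgroupOf (integralForms Φ (2 * p)))))) :
        ↥(integralForms Φ (2 * p))) = a • (γM : ↥(integralForms Φ (2 * p))) from rfl, map_zsmul, zsmul_eq_mul, Int.cast_id, mul_eq_zero] at h'
    exact h'.resolve_right h0
  exact ⟨line_inf_orthogonal_eq_bot _ γM Λ hΛ h0, hnd, finrank_line_eq_one γM Λ hΛ htf,
    LinearMap.BilinForm.finrank_add_finrank_orthogonal_of_nondegenerate _ Λ (hBs.restrict _) hnd⟩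

end Splitting

/-! ## §3 The tower `Hdgᵖ(X, ℤ) ⊇ ℤγ_p ⊕ γ_p^⊥ ⊇ ⊕_s M_s ⊇ ⊕_s N_s`: `J_p ∣ I'_p ∣ I_p` -/

section Tower

variable {ι : Type*} [Fintype ι] [DecidableEq ι] {E : Type*} [NormedAddCommGroup E] [NormedSpace ℂ E]
  {Φ : (ι → ℝ) ≃L[ℝ] E} {j n p q : ℕ} {η : E [⋀^Fin 2]→L[ℝ] ℝ} {d : Fin (j + 2) → ℕ}

/-- **The lower Lefschetz pieces are orthogonal to the minimal class: `B(γ_p, N_s) = 0` for `s < p`** (`N_p = ℤθ^{∧p} = (p!·d₁⋯d_p)·ℤγ_p` is `B`-orthogonal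
to the other pieces, g47-#3, and `H^{2p}(X, ℤ)` is torsion free). [cite: VoisinHodgeI2002, §6.3.2 Lemma 6.31 (PDF p. 128)] [cite: Lange2023AbelianVarietiesComplex, §5.4.1 Thm. 5.4.2 (PDF p. 275); §7.3.2 (3)] -/
theorem IsPolarizationType.apply_minimalClass_eq_zero_of_mem_lefschetzPiece (hd : IsPolarizationType Φ η d) (hη : IsRiemannForm Φ η)
    (hp : p ≤ j + 2) (hkq : 2 * p + q = j + 2) (hq : q ≤ j + 2)
    {γq : E [⋀^Fin (2 * q)]→L[ℝ] ℂ} (hγq : wedgePow (ofRealForm η) q = ((q.factorial * ∏ i : Fin q, d (Fin.castLE hq i) : ℕ) : ℂ) • γq)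
    (e : Fin n ≃ ι) (hn : 2 * p + (2 * q + 2 * p) = n) {B : BilinForm ℤ ↥(integralForms Φ (2 * p))}
    (hB : ∀ x y : ↥(integralForms Φ (2 * p)),
      ((B x y : ℤ) : ℂ) = poincarePairing Φ e hn (x : E [⋀^Fin (2 * p)]→L[ℝ] ℂ) (γq.wedge (y : E [⋀^Fin (2 * p)]→L[ℝ] ℂ)))
    (γpZ : ↥(integralForms Φ (2 * p)))
    (hγpZ : wedgePow (ofRealForm η) p = ((p.factorial * ∏ i : Fin p, d (Fin.castLE hp i) : ℕ) : ℂ) • (γpZ : E [⋀^Fin (2 * p)]→L[ℝ] ℂ))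
    (N : Fin (p + 1) → Submodule ℤ ↥(integralForms Φ (2 * p)))
    (hN : ∀ (s : Fin (p + 1)) (u : ↥(integralForms Φ (2 * p))), u ∈ N s ↔
      ∃ (m i : ℕ) (_ : i + i = m) (h : 2 * (s : ℕ) + m = 2 * p) (y : E [⋀^Fin m]→L[ℝ] ℂ),
        y ∈ integralHodgeClassesIn Φ m i ∧ y ∈ primitiveForms η m ∧ (u : E [⋀^Fin (2 * p)]→L[ℝ] ℂ) = lefschetzPow η (s : ℕ) h y)
    {s : Fin (p + 1)} (hs : s ≠ Fin.last p) {v : ↥(integralForms Φ (2 * p))} (hv : v ∈ N s) : B γpZ v = 0 := by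
  obtain ⟨-, hO, -⟩ := hd.iSupIndep_lefschetzPieces hη hkq hq hγq e hn hB N hN
  have hθZ : wedgePow (ofRealForm η) p ∈ integralForms Φ (2 * p) :=
    integralHodgeClassesIn_le_integralForms Φ _ _ (hη.wedgePow_ofRealForm_mem_integralHodgeClassesIn p)
  have hθN : (⟨wedgePow (ofRealForm η) p, hθZ⟩ : ↥(integralForms Φ (2 * p))) ∈ N (Fin.last p) :=
    (mem_lefschetzPiece_last_iff η N hN _).2 ⟨1, by rw [Int.cast_one, one_smul]⟩
  have hBs : B.IsSymm := hd.isSymm_of_eq_poincarePairing_wedge_of_even hη (even_two_mul p) hkq hq hγq e hn hB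
  have h1 : B v ⟨wedgePow (ofRealForm η) p, hθZ⟩ = 0 := hO s (Fin.last p) hs v hv _ hθN
  have hθγ : (⟨wedgePow (ofRealForm η) p, hθZ⟩ : ↥(integralForms Φ (2 * p))) = (p.factorial * ∏ i : Fin p, d (Fin.castLE hp i)) • γpZ :=
    Subtype.ext (by rw [AddSubmonoidClass.coe_nsmul, ← Nat.cast_smul_eq_nsmul ℂ, ← hγpZ])
  have hc : ((p.factorial * ∏ i : Fin p, d (Fin.castLE hp i) : ℕ) : ℤ) ≠ 0 := by
    exact_mod_cast (Nat.mul_pos (Nat.factorial_pos p) (Finset.prod_pos fun i _ ↦ hd.pos hη _)).ne'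
  rw [hθγ, map_nsmul, nsmul_eq_mul, mul_eq_zero] at h1
  rw [hBs.eq]
  exact h1.resolve_left hc

/-- **The lower minimal-class pieces are orthogonal to the minimal class: `B(γ_p, M_s) = 0` for `s < p`** (`(s!·d₁⋯d_s)·M_s = N_s`).
[cite: VoisinHodgeI2002, §6.3.2 Lemma 6.31 (PDF p. 128)] [cite: Lange2023AbelianVarietiesComplex, §5.4.1 Thm. 5.4.2 and (5.22) (PDF p. 275)] -/
theorem IsPolarizationType.apply_minimalClass_eq_zero_of_mem_minimalClassPiece (hd : IsPolarizationType Φ η d) (hη : IsRiemannForm Φ η)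
    (hp : p ≤ j + 2) (hkq : 2 * p + q = j + 2) (hq : q ≤ j + 2)
    {γq : E [⋀^Fin (2 * q)]→L[ℝ] ℂ} (hγq : wedgePow (ofRealForm η) q = ((q.factorial * ∏ i : Fin q, d (Fin.castLE hq i) : ℕ) : ℂ) • γq)
    (e : Fin n ≃ ι) (hn : 2 * p + (2 * q + 2 * p) = n) {B : BilinForm ℤ ↥(integralForms Φ (2 * p))}
    (hB : ∀ x y : ↥(integralForms Φ (2 * p)),
      ((B x y : ℤ) : ℂ) = poincarePairing Φ e hn (x : E [⋀^Fin (2 * p)]→L[ℝ] ℂ) (γq.wedge (y : E [⋀^Fin (2 * p)]→L[ℝ] ℂ)))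
    (γpZ : ↥(integralForms Φ (2 * p)))
    (hγpZ : wedgePow (ofRealForm η) p = ((p.factorial * ∏ i : Fin p, d (Fin.castLE hp i) : ℕ) : ℂ) • (γpZ : E [⋀^Fin (2 * p)]→L[ℝ] ℂ))
    (N : Fin (p + 1) → Submodule ℤ ↥(integralForms Φ (2 * p)))
    (hN : ∀ (s : Fin (p + 1)) (u : ↥(integralForms Φ (2 * p))), u ∈ N s ↔
      ∃ (m i : ℕ) (_ : i + i = m) (h : 2 * (s : ℕ) + m = 2 * p) (y : E [⋀^Fin m]→L[ℝ] ℂ),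
        y ∈ integralHodgeClassesIn Φ m i ∧ y ∈ primitiveForms η m ∧ (u : E [⋀^Fin (2 * p)]→L[ℝ] ℂ) = lefschetzPow η (s : ℕ) h y)
    (M : Fin (p + 1) → Submodule ℤ ↥(integralForms Φ (2 * p)))
    (hM : ∀ (s : Fin (p + 1)) (u : ↥(integralForms Φ (2 * p))), u ∈ M s ↔
      ((s : ℕ).factorial * ∏ i : Fin s, d (Fin.castLE ((Nat.le_of_lt_succ s.isLt).trans hp) i)) • u ∈ N s)
    {s : Fin (p + 1)} (hs : s ≠ Fin.last p) {u : ↥(integralForms Φ (2 * p))} (hu : u ∈ M s) : B γpZ u = 0 := by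
  have h1 := hd.apply_minimalClass_eq_zero_of_mem_lefschetzPiece hη hp hkq hq hγq e hn hB γpZ hγpZ N hN hs ((hM s u).1 hu)
  have hc : (((s : ℕ).factorial * ∏ i : Fin s, d (Fin.castLE ((Nat.le_of_lt_succ s.isLt).trans hp) i) : ℕ) : ℤ) ≠ 0 := by
    exact_mod_cast (Nat.mul_pos (Nat.factorial_pos _) (Finset.prod_pos fun i _ ↦ hd.pos hη _)).ne'
  rw [map_nsmul, nsmul_eq_mul, mul_eq_zero] at h1
  exact h1.resolve_left hc

omit [DecidableEq ι] in
/-- **The top minimal-class piece is the line of the minimal class: `M_p = ℤγ_p`** (`u ∈ M_p ⟺ (p!·d₁⋯d_p)·u ∈ ℤθ^{∧p} = (p!·d₁⋯d_p)·ℤγ_p`, and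
`H^{2p}(X, ℤ)` is torsion free). [cite: Lange2023AbelianVarietiesComplex, §2.5.3 Thm. 2.5.16 (PDF p. 135); §5.4.1 (5.22) (PDF p. 275)] -/
theorem mem_minimalClassPiece_last_iff (hp : p ≤ j + 2) (hc : 0 < p.factorial * ∏ i : Fin p, d (Fin.castLE hp i))
    (γpZ : ↥(integralForms Φ (2 * p)))
    (hγpZ : wedgePow (ofRealForm η) p = ((p.factorial * ∏ i : Fin p, d (Fin.castLE hp i) : ℕ) : ℂ) • (γpZ : E [⋀^Fin (2 * p)]→L[ℝ] ℂ))
    (N : Fin (p + 1) → Submodule ℤ ↥(integralForms Φ (2 * p)))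
    (hN : ∀ (s : Fin (p + 1)) (u : ↥(integralForms Φ (2 * p))), u ∈ N s ↔
      ∃ (m i : ℕ) (_ : i + i = m) (h : 2 * (s : ℕ) + m = 2 * p) (y : E [⋀^Fin m]→L[ℝ] ℂ),
        y ∈ integralHodgeClassesIn Φ m i ∧ y ∈ primitiveForms η m ∧ (u : E [⋀^Fin (2 * p)]→L[ℝ] ℂ) = lefschetzPow η (s : ℕ) h y)
    (M : Fin (p + 1) → Submodule ℤ ↥(integralForms Φ (2 * p)))
    (hM : ∀ (s : Fin (p + 1)) (u : ↥(integralForms Φ (2 * p))), u ∈ M s ↔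
      ((s : ℕ).factorial * ∏ i : Fin s, d (Fin.castLE ((Nat.le_of_lt_succ s.isLt).trans hp) i)) • u ∈ N s)
    (u : ↥(integralForms Φ (2 * p))) : u ∈ M (Fin.last p) ↔ ∃ a : ℤ, a • γpZ = u := by
  have hc' : ((p.factorial * ∏ i : Fin p, d (Fin.castLE hp i) : ℕ) : ℂ) ≠ 0 := by exact_mod_cast hc.ne'
  -- the content in degree `s = p` (the value `(Fin.last p : ℕ) = p` definitionally)
  have hlast : ∀ w : ↥(integralForms Φ (2 * p)), w ∈ M (Fin.last p) ↔ (p.factorial * ∏ i : Fin p, d (Fin.castLE hp i)) • w ∈ N (Fin.last p) :=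
    fun w ↦ hM (Fin.last p) w
  rw [hlast, mem_lefschetzPiece_last_iff η N hN]
  constructor
  · rintro ⟨c, hcu⟩
    rw [AddSubmonoidClass.coe_nsmul, ← Nat.cast_smul_eq_nsmul ℂ, hγpZ, smul_comm] at hcu
    refine ⟨c, Subtype.ext ?_⟩
    rw [AddSubgroupClass.coe_zsmul, ← Int.cast_smul_eq_zsmul ℂ]
    exact (smul_right_injective (E [⋀^Fin (2 * p)]→L[ℝ] ℂ) hc' hcu).symm
  · rintro ⟨a, rfl⟩
    refine ⟨a, ?_⟩
    rw [AddSubmonoidClass.coe_nsmul, AddSubgroupClass.coe_zsmul, ← Nat.cast_smul_eq_nsmul ℂ, ← Int.cast_smul_eq_zsmul ℂ, hγpZ, smul_comm]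

/-- **THE TOWER `ℤγ_p ⊕ γ_p^⊥ ⊇ ⊕_s M_s`**: the minimal-class decomposition of g48-#4 sits inside the top splitting (`M_p = ℤγ_p`, `M_s ⊆ γ_p^⊥` for `s < p`).
[cite: Lange2023AbelianVarietiesComplex, §5.4.1 Thm. 5.4.2 and (5.22) (PDF p. 275); §7.3.2 (3)] [cite: VoisinHodgeI2002, §6.3.2 Lemma 6.31 (PDF p. 128)] -/
theorem IsPolarizationType.comap_subtype_iSup_minimalClassPieces_le_top_splitting (hd : IsPolarizationType Φ η d) (hη : IsRiemannForm Φ η)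
    (hp : p ≤ j + 2) (hkq : 2 * p + q = j + 2) (hq : q ≤ j + 2)
    {γq : E [⋀^Fin (2 * q)]→L[ℝ] ℂ} (hγq : wedgePow (ofRealForm η) q = ((q.factorial * ∏ i : Fin q, d (Fin.castLE hq i) : ℕ) : ℂ) • γq)
    (e : Fin n ≃ ι) (hn : 2 * p + (2 * q + 2 * p) = n) {B : BilinForm ℤ ↥(integralForms Φ (2 * p))}
    (hB : ∀ x y : ↥(integralForms Φ (2 * p)),
      ((B x y : ℤ) : ℂ) = poincarePairing Φ e hn (x : E [⋀^Fin (2 * p)]→L[ℝ] ℂ) (γq.wedge (y : E [⋀^Fin (2 * p)]→L[ℝ] ℂ)))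
    (γM : ↥(AddSubgroup.toIntSubmodule ((integralHodgeClassesIn Φ (2 * p) p).addSubgroupOf (integralForms Φ (2 * p)))))
    (hγM : wedgePow (ofRealForm η) p = ((p.factorial * ∏ i : Fin p, d (Fin.castLE hp i) : ℕ) : ℂ) •
      (((γM : ↥(AddSubgroup.toIntSubmodule ((integralHodgeClassesIn Φ (2 * p) p).addSubgroupOf (integralForms Φ (2 * p))))) :
        ↥(integralForms Φ (2 * p))) : E [⋀^Fin (2 * p)]→L[ℝ] ℂ))
    (Λ : Submodule ℤ ↥(AddSubgroup.toIntSubmodule ((integralHodgeClassesIn Φ (2 * p) p).addSubgroupOf (integralForms Φ (2 * p)))))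
    (hΛ : ∀ x, x ∈ Λ ↔ ∃ a : ℤ, a • γM = x)
    (N : Fin (p + 1) → Submodule ℤ ↥(integralForms Φ (2 * p)))
    (hN : ∀ (s : Fin (p + 1)) (u : ↥(integralForms Φ (2 * p))), u ∈ N s ↔
      ∃ (m i : ℕ) (_ : i + i = m) (h : 2 * (s : ℕ) + m = 2 * p) (y : E [⋀^Fin m]→L[ℝ] ℂ),
        y ∈ integralHodgeClassesIn Φ m i ∧ y ∈ primitiveForms η m ∧ (u : E [⋀^Fin (2 * p)]→L[ℝ] ℂ) = lefschetzPow η (s : ℕ) h y)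
    (M : Fin (p + 1) → Submodule ℤ ↥(integralForms Φ (2 * p)))
    (hM : ∀ (s : Fin (p + 1)) (u : ↥(integralForms Φ (2 * p))), u ∈ M s ↔
      ((s : ℕ).factorial * ∏ i : Fin s, d (Fin.castLE ((Nat.le_of_lt_succ s.isLt).trans hp) i)) • u ∈ N s) :
    (⨆ s, M s).comap (AddSubgroup.toIntSubmodule ((integralHodgeClassesIn Φ (2 * p) p).addSubgroupOf (integralForms Φ (2 * p)))).subtype ≤
      Λ ⊔ (B.restrict (AddSubgroup.toIntSubmodule ((integralHodgeClassesIn Φ (2 * p) p).addSubgroupOf (integralForms Φ (2 * p))))).orthogonal Λ := by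
  have hc : 0 < p.factorial * ∏ i : Fin p, d (Fin.castLE hp i) := Nat.mul_pos (Nat.factorial_pos p) (Finset.prod_pos fun i _ ↦ hd.pos hη _)
  have key : (⨆ s, M s) ≤ (Λ ⊔ (B.restrict (AddSubgroup.toIntSubmodule ((integralHodgeClassesIn Φ (2 * p) p).addSubgroupOf
      (integralForms Φ (2 * p))))).orthogonal Λ).map
      (AddSubgroup.toIntSubmodule ((integralHodgeClassesIn Φ (2 * p) p).addSubgroupOf (integralForms Φ (2 * p)))).subtype := by
    refine iSup_le fun s u hu ↦ ?_
    have huM : u ∈ AddSubgroup.toIntSubmodule ((integralHodgeClassesIn Φ (2 * p) p).addSubgroupOf (integralForms Φ (2 * p))) :=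
      hd.minimalClassPiece_le_toIntSubmodule hη hp (two_mul p).symm N hN M hM s hu
    refine ⟨⟨u, huM⟩, ?_, rfl⟩
    by_cases hs : s = Fin.last p
    · subst hs
      obtain ⟨a, ha⟩ := (mem_minimalClassPiece_last_iff hp hc (γM : ↥(integralForms Φ (2 * p))) hγM N hN M hM u).1 hu
      exact Submodule.mem_sup_left ((hΛ _).2 ⟨a, Subtype.ext ha⟩)
    · have hBs : B.IsSymm := hd.isSymm_of_eq_poincarePairing_wedge_of_even hη (even_two_mul p) hkq hq hγq e hn hB
      have h0 : B u (γM : ↥(integralForms Φ (2 * p))) = 0 := by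
        rw [hBs.eq]
        exact hd.apply_minimalClass_eq_zero_of_mem_minimalClassPiece hη hp hkq hq hγq e hn hB (γM : ↥(integralForms Φ (2 * p))) hγM N hN M hM hs hu
      refine Submodule.mem_sup_right (LinearMap.BilinForm.mem_orthogonal_iff.2 fun x hx ↦ ?_)
      obtain ⟨a, rfl⟩ := (hΛ x).1 hx
      show B (((a • γM : ↥(AddSubgroup.toIntSubmodule ((integralHodgeClassesIn Φ (2 * p) p).addSubgroupOf (integralForms Φ (2 * p)))))) :
        ↥(integralForms Φ (2 * p))) u = 0
      rw [show (((a • γM : ↥(AddSubgroup.toIntSubmodule ((integralHodgeClassesIn Φ (2 * p) p).addSubgroupOf (integralForms Φ (2 * p)))))) :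
          ↥(integralForms Φ (2 * p))) = a • (γM : ↥(integralForms Φ (2 * p))) from rfl, hBs.eq, map_zsmul, h0, smul_zero]
  intro z hz
  obtain ⟨w, hw, hwz⟩ := key hz
  obtain rfl : w = z := Subtype.ext hwz
  exact hw

/-- **`J_p ∣ I'_p ∣ I_p`: the index of the top splitting divides the index of the minimal-class decomposition**, in both currencies (the trace on
`M = Hdgᵖ(X, ℤ) ⊆ H^{2p}(X, ℤ)` and the pull-back along `Hdgᵖ(X, ℤ) ↪ H^{2p}(X, ℤ)` of g47-#4/g48-#4), and the index of the Lefschetz decomposition itself.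
[cite: Lange2023AbelianVarietiesComplex, §5.4.1 Thm. 5.4.2 and (5.22)–(5.23) (PDF p. 275); §7.3.2 (3)] [cite: Huybrechts2016K3, Ch. 14 §0.1–§0.2] -/
theorem IsPolarizationType.index_top_splitting_dvd_index_comap_iSup_minimalClassPieces (hd : IsPolarizationType Φ η d) (hη : IsRiemannForm Φ η)
    (hp : p ≤ j + 2) (hkq : 2 * p + q = j + 2) (hq : q ≤ j + 2)
    {γq : E [⋀^Fin (2 * q)]→L[ℝ] ℂ} (hγq : wedgePow (ofRealForm η) q = ((q.factorial * ∏ i : Fin q, d (Fin.castLE hq i) : ℕ) : ℂ) • γq)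
    (e : Fin n ≃ ι) (hn : 2 * p + (2 * q + 2 * p) = n) {B : BilinForm ℤ ↥(integralForms Φ (2 * p))}
    (hB : ∀ x y : ↥(integralForms Φ (2 * p)),
      ((B x y : ℤ) : ℂ) = poincarePairing Φ e hn (x : E [⋀^Fin (2 * p)]→L[ℝ] ℂ) (γq.wedge (y : E [⋀^Fin (2 * p)]→L[ℝ] ℂ)))
    (γM : ↥(AddSubgroup.toIntSubmodule ((integralHodgeClassesIn Φ (2 * p) p).addSubgroupOf (integralForms Φ (2 * p)))))
    (hγM : wedgePow (ofRealForm η) p = ((p.factorial * ∏ i : Fin p, d (Fin.castLE hp i) : ℕ) : ℂ) •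
      (((γM : ↥(AddSubgroup.toIntSubmodule ((integralHodgeClassesIn Φ (2 * p) p).addSubgroupOf (integralForms Φ (2 * p))))) :
        ↥(integralForms Φ (2 * p))) : E [⋀^Fin (2 * p)]→L[ℝ] ℂ))
    (Λ : Submodule ℤ ↥(AddSubgroup.toIntSubmodule ((integralHodgeClassesIn Φ (2 * p) p).addSubgroupOf (integralForms Φ (2 * p)))))
    (hΛ : ∀ x, x ∈ Λ ↔ ∃ a : ℤ, a • γM = x)
    (N : Fin (p + 1) → Submodule ℤ ↥(integralForms Φ (2 * p)))
    (hN : ∀ (s : Fin (p + 1)) (u : ↥(integralForms Φ (2 * p))), u ∈ N s ↔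
      ∃ (m i : ℕ) (_ : i + i = m) (h : 2 * (s : ℕ) + m = 2 * p) (y : E [⋀^Fin m]→L[ℝ] ℂ),
        y ∈ integralHodgeClassesIn Φ m i ∧ y ∈ primitiveForms η m ∧ (u : E [⋀^Fin (2 * p)]→L[ℝ] ℂ) = lefschetzPow η (s : ℕ) h y)
    (M : Fin (p + 1) → Submodule ℤ ↥(integralForms Φ (2 * p)))
    (hM : ∀ (s : Fin (p + 1)) (u : ↥(integralForms Φ (2 * p))), u ∈ M s ↔
      ((s : ℕ).factorial * ∏ i : Fin s, d (Fin.castLE ((Nat.le_of_lt_succ s.isLt).trans hp) i)) • u ∈ N s) :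
    (Λ ⊔ (B.restrict (AddSubgroup.toIntSubmodule ((integralHodgeClassesIn Φ (2 * p) p).addSubgroupOf (integralForms Φ (2 * p))))).orthogonal Λ).toAddSubgroup.index ∣
        ((⨆ s, M s).comap (AddSubgroup.toIntSubmodule ((integralHodgeClassesIn Φ (2 * p) p).addSubgroupOf (integralForms Φ (2 * p)))).subtype).toAddSubgroup.index ∧
      (Λ ⊔ (B.restrict (AddSubgroup.toIntSubmodule ((integralHodgeClassesIn Φ (2 * p) p).addSubgroupOf (integralForms Φ (2 * p))))).orthogonal Λ).toAddSubgroup.index ∣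
        ((⨆ s, M s).comap (AddSubgroup.inclusion (integralHodgeClassesIn_le_integralForms Φ (2 * p) p)).toIntLinearMap).toAddSubgroup.index ∧
      (Λ ⊔ (B.restrict (AddSubgroup.toIntSubmodule ((integralHodgeClassesIn Φ (2 * p) p).addSubgroupOf (integralForms Φ (2 * p))))).orthogonal Λ).toAddSubgroup.index ∣
        ((⨆ s, N s).comap (AddSubgroup.inclusion (integralHodgeClassesIn_le_integralForms Φ (2 * p) p)).toIntLinearMap).toAddSubgroup.index := by
  have hle := hd.comap_subtype_iSup_minimalClassPieces_le_top_splitting hη hp hkq hq hγq e hn hB γM hγM Λ hΛ N hN M hM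
  have h1 : (Λ ⊔ (B.restrict (AddSubgroup.toIntSubmodule ((integralHodgeClassesIn Φ (2 * p) p).addSubgroupOf
      (integralForms Φ (2 * p))))).orthogonal Λ).toAddSubgroup.index ∣
      ((⨆ s, M s).comap (AddSubgroup.toIntSubmodule ((integralHodgeClassesIn Φ (2 * p) p).addSubgroupOf (integralForms Φ (2 * p)))).subtype).toAddSubgroup.index :=
    AddSubgroup.index_dvd_of_le (Submodule.toAddSubgroup_mono hle)
  have hM' : ∀ x : ↥(integralForms Φ (2 * p)), x ∈ AddSubgroup.toIntSubmodule ((integralHodgeClassesIn Φ (2 * p) p).addSubgroupOf (integralForms Φ (2 * p))) ↔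
      IsOfTypeAt p p (x : E [⋀^Fin (2 * p)]→L[ℝ] ℂ) := fun x ↦ by
    change x ∈ (integralHodgeClassesIn Φ (2 * p) p).addSubgroupOf (integralForms Φ (2 * p)) ↔ _
    rw [AddSubgroup.mem_addSubgroupOf, mem_integralHodgeClassesIn_iff, mem_typeSubmodule_iff_isOfTypeAt (two_mul p).symm]
    exact ⟨fun h ↦ h.2, fun h ↦ ⟨x.2, h⟩⟩
  have h2 := h1
  rw [index_comap_subtype_eq_index_comap_inclusion (two_mul p).symm hM'] at h2
  refine ⟨h1, h2, h2.trans (AddSubgroup.index_dvd_of_le fun x hx ↦ ?_)⟩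
  exact iSup_mono (fun s ↦ lefschetzPiece_le_minimalClassPiece hp N M hM s) hx

/-- **THE TOP SPLITTING, DATA-FREE** (`2p + q = g`): there are the minimal class `γ_p ∈ Hdgᵖ(X, ℤ)` (`θ^{∧p} = (p!·d₁⋯d_p)·γ_p`) and a symmetric integral
Lefschetz form `B = ⟨·, γ_q ∧ ·⟩_e` on `H^{2p}(X, ℤ)` such that, for the line `Λ = ℤγ_p ⊆ M = Hdgᵖ(X, ℤ)` and `Λ^⊥` its `B∣M`-orthogonal:
`[M : Λ ⊕ Λ^⊥] · [ℤ : B(γ_p, M)] · (p!·d₁⋯d_p)²·(q!·d₁⋯d_q) = g!·d₁⋯d_g`, `0 < [M : Λ ⊕ Λ^⊥]`, `Λ ∩ Λ^⊥ = 0`, `rk Λ = 1`, `rk Λ + rk Λ^⊥ = rk M`, and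
`[M : Λ ⊕ Λ^⊥]` divides the index `I'_p` of every minimal-class decomposition and the index `I_p` of the integral Lefschetz decomposition (g47-#4's currency).
[cite: Lange2023AbelianVarietiesComplex, §5.4.1 Thm. 5.4.2 and (5.22)–(5.23) (PDF p. 275); §2.5.3 Thm. 2.5.16, Cor. 2.5.17 (d) (PDF p. 135); §7.3.2 (3)]
[cite: VoisinHodgeI2002, §6.3.2 Lemma 6.31 (PDF p. 128); §7.1.2 (PDF p. 134)] [cite: Kitaoka1993, Ch. 5 Prop. 5.3.3 (proof)] [cite: Huybrechts2016K3, Ch. 14 §0.1–§0.2] -/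
theorem IsPolarizationType.exists_top_splitting (hd : IsPolarizationType Φ η d) (hη : IsRiemannForm Φ η) (hp : p ≤ j + 2) (hq : q ≤ j + 2)
    (hkq : 2 * p + q = j + 2) :
    ∃ (γM : ↥(AddSubgroup.toIntSubmodule ((integralHodgeClassesIn Φ (2 * p) p).addSubgroupOf (integralForms Φ (2 * p)))))
      (B : BilinForm ℤ ↥(integralForms Φ (2 * p))),
      wedgePow (ofRealForm η) p = ((p.factorial * ∏ i : Fin p, d (Fin.castLE hp i) : ℕ) : ℂ) •
        (((γM : ↥(AddSubgroup.toIntSubmodule ((integralHodgeClassesIn Φ (2 * p) p).addSubgroupOf (integralForms Φ (2 * p))))) :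
          ↥(integralForms Φ (2 * p))) : E [⋀^Fin (2 * p)]→L[ℝ] ℂ) ∧ B.IsSymm ∧
      ∀ (Λ : Submodule ℤ ↥(AddSubgroup.toIntSubmodule ((integralHodgeClassesIn Φ (2 * p) p).addSubgroupOf (integralForms Φ (2 * p))))),
        (∀ x, x ∈ Λ ↔ ∃ a : ℤ, a • γM = x) →
        (Λ ⊔ (B.restrict (AddSubgroup.toIntSubmodule ((integralHodgeClassesIn Φ (2 * p) p).addSubgroupOf (integralForms Φ (2 * p))))).orthogonal Λ).toAddSubgroup.index *
            (LinearMap.range (B.restrict (AddSubgroup.toIntSubmodule ((integralHodgeClassesIn Φ (2 * p) p).addSubgroupOf (integralForms Φ (2 * p)))) γM)).toAddSubgroup.index *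
              ((p.factorial * ∏ i : Fin p, d (Fin.castLE hp i)) ^ 2 * (q.factorial * ∏ i : Fin q, d (Fin.castLE hq i))) = (j + 2).factorial * ∏ i, d i ∧
          0 < (Λ ⊔ (B.restrict (AddSubgroup.toIntSubmodule ((integralHodgeClassesIn Φ (2 * p) p).addSubgroupOf (integralForms Φ (2 * p))))).orthogonal Λ).toAddSubgroup.index ∧
          Λ ⊓ (B.restrict (AddSubgroup.toIntSubmodule ((integralHodgeClassesIn Φ (2 * p) p).addSubgroupOf (integralForms Φ (2 * p))))).orthogonal Λ = ⊥ ∧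
          finrank ℤ ↥Λ = 1 ∧
          finrank ℤ ↥Λ + finrank ℤ ↥((B.restrict (AddSubgroup.toIntSubmodule ((integralHodgeClassesIn Φ (2 * p) p).addSubgroupOf (integralForms Φ (2 * p))))).orthogonal Λ) =
            finrank ℤ ↥(AddSubgroup.toIntSubmodule ((integralHodgeClassesIn Φ (2 * p) p).addSubgroupOf (integralForms Φ (2 * p)))) ∧
          ∀ (N : Fin (p + 1) → Submodule ℤ ↥(integralForms Φ (2 * p))),
            (∀ (s : Fin (p + 1)) (u : ↥(integralForms Φ (2 * p))), u ∈ N s ↔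
              ∃ (m i : ℕ) (_ : i + i = m) (h : 2 * (s : ℕ) + m = 2 * p) (y : E [⋀^Fin m]→L[ℝ] ℂ),
                y ∈ integralHodgeClassesIn Φ m i ∧ y ∈ primitiveForms η m ∧ (u : E [⋀^Fin (2 * p)]→L[ℝ] ℂ) = lefschetzPow η (s : ℕ) h y) →
            ∀ (M : Fin (p + 1) → Submodule ℤ ↥(integralForms Φ (2 * p))),
              (∀ (s : Fin (p + 1)) (u : ↥(integralForms Φ (2 * p))), u ∈ M s ↔
                ((s : ℕ).factorial * ∏ i : Fin s, d (Fin.castLE ((Nat.le_of_lt_succ s.isLt).trans hp) i)) • u ∈ N s) →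
              (Λ ⊔ (B.restrict (AddSubgroup.toIntSubmodule ((integralHodgeClassesIn Φ (2 * p) p).addSubgroupOf (integralForms Φ (2 * p))))).orthogonal Λ).toAddSubgroup.index ∣
                  ((⨆ s, M s).comap (AddSubgroup.inclusion (integralHodgeClassesIn_le_integralForms Φ (2 * p) p)).toIntLinearMap).toAddSubgroup.index ∧
                (Λ ⊔ (B.restrict (AddSubgroup.toIntSubmodule ((integralHodgeClassesIn Φ (2 * p) p).addSubgroupOf (integralForms Φ (2 * p))))).orthogonal Λ).toAddSubgroup.index ∣
                  ((⨆ s, N s).comap (AddSubgroup.inclusion (integralHodgeClassesIn_le_integralForms Φ (2 * p) p)).toIntLinearMap).toAddSubgroup.index := by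
  refine (hd.exists_minimalClass_mem_toIntSubmodule hη hp).elim fun γM hγM ↦ ?_
  refine (hd.exists_mem_integralForms_wedgePow_eq_content_smul hq).elim fun γq hγq' ↦ ?_
  have hγqZ := hγq'.1
  have hγq := hγq'.2
  have hcard : Fintype.card ι = 2 * p + (2 * q + 2 * p) := by rw [hd.card_eq]; omega
  let e : Fin (2 * p + (2 * q + 2 * p)) ≃ ι := (Fintype.equivFinOfCardEq hcard).symm
  refine (exists_bilinForm_eq_poincarePairing_wedge_of_degree Φ hγqZ e rfl).elim fun B hB ↦ ?_
  have hg : p + (q + p) = j + 2 := by omega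
  refine ⟨γM, B, hγM, hd.isSymm_of_eq_poincarePairing_wedge_of_even hη (even_two_mul p) hkq hq hγq e rfl hB, fun Λ hΛ ↦ ?_⟩
  have h1 := hd.index_top_splitting_mul_index_range_mul_content_eq hη hp hq hg hγq e rfl hB γM hγM Λ hΛ
  have h2 := hd.top_splitting hη hp hq hg hγq e rfl hB γM hγM Λ hΛ
  refine ⟨?_, ?_, ?_, ?_, ?_, fun N hN M hM ↦ ?_⟩
  · exact h1.1
  · exact h1.2.2.1
  · exact h2.1
  · exact h2.2.2.1
  · exact h2.2.2.2
  · exact (hd.index_top_splitting_dvd_index_comap_iSup_minimalClassPieces hη hp hkq hq hγq e rfl hB γM hγM Λ hΛ N hN M hM).2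

end Tower

end Literature.Geometry.Kaehler.ComplexTorus

end
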